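import Mathlib.Analysis.Normed.Module.Connected
import Mathlib.Analysis.SpecialFunctions.Sqrt
import HarnessLib

/-!
# Connectedness of complements: a gluing principle and two local models

Topic `Literature/Topology/FourManifolds` (generic point-set lemmas; fact seat
`provefact-Literature.Geometry.Symplectic.Oba2016_s-add47373d4`, where the complement of a singular fibre of a
Lefschetz fibration in a small ball, and the complement of the vertical boundary in a boundary
chart, must be connected in order to propagate the "which boundary circles does my fibre
component reach" labels across singular fibres — the connectedness of the regular fibre).

* `IsPreconnected.diff_of_isClosed_of_forall_exists_nhds` — **gluing principle**: if `M` is open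
  and preconnected, `S` is closed with empty interior, and every point of `M ∩ S` has a
  neighbourhood `V ⊆ M` with `V \ S` preconnected, then `M \ S` is preconnected (a separation
  of `M \ S` would have closures meeting at a point of `S`, near which `V \ S` is separated);
* `isPreconnected_ball_diff_center` — a punctured open ball in a real normed space of dimension
  `> 1` is preconnected (image of `(0, r) × 𝕊`);
* `isPreconnected_ball_diff_submodule` — an open ball about `0` minus a linear subspace of
  codimension `> 1` is preconnected (radial homeomorphism with the whole space, where
  `isConnected_compl_of_one_lt_codim` applies), and its translate
  `isPreconnected_ball_diff_vadd_submodule`.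

Everything is proved; no definitions, no named facts.

## References

* J. R. Munkres, *Topology*, 2nd ed. (2000), §23–§24 (connectedness of unions and closures).
  [folklore]
-/

open Set Function Filter Metric Topology

noncomputable section

namespace Literature.Topology.FourManifolds

/-! ### §1 The gluing principle -/

/-- **Gluing principle for connected complements.**  Let `M` be open and preconnected, `S`
closed with empty interior, and suppose every point of `M ∩ S` has a neighbourhood `V ⊆ M` with
`V \ S` preconnected.  Then `M \ S` is preconnected. [folklore] -/
theorem IsPreconnected.diff_of_isClosed_of_forall_exists_nhds {X : Type*} [TopologicalSpace X]
    {M S : Set X} (hM : IsPreconnected M) (hMo : IsOpen M) (hS : IsClosed S)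
    (hint : interior S = ∅)
    (hloc : ∀ x ∈ M ∩ S, ∃ V ∈ 𝓝 x, V ⊆ M ∧ IsPreconnected (V \ S)) :
    IsPreconnected (M \ S) := by
  -- density of `M \ S` in `M`
  have hdense : M ⊆ closure (M \ S) := by
    intro x hx
    rw [mem_closure_iff_nhds]
    intro N hN
    by_contra h
    rw [not_nonempty_iff_eq_empty] at h
    have hsub : N ∩ M ⊆ S := by
      intro y hy
      by_contra hyS
      have : y ∈ N ∩ (M \ S) := ⟨hy.1, hy.2, hyS⟩
      rw [h] at this
      exact this
    have hopen : N ∩ M ∈ 𝓝 x := inter_mem hN (hMo.mem_nhds hx)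
    have : x ∈ interior S := interior_mono hsub (mem_interior_iff_mem_nhds.2 hopen)
    rw [hint] at this
    exact this
  intro u v hu hv hsub hne_u hne_v
  by_contra hempty
  rw [not_nonempty_iff_eq_empty] at hempty
  set A : Set X := (M \ S) ∩ u with hA
  set B : Set X := (M \ S) ∩ v with hB
  have hAo : IsOpen A := (hMo.sdiff hS).inter hu
  have hBo : IsOpen B := (hMo.sdiff hS).inter hv
  have hAB : Disjoint A B := by
    rw [Set.disjoint_iff]
    rintro y ⟨⟨hy, hyu⟩, -, hyv⟩
    have : y ∈ (M \ S) ∩ (u ∩ v) := ⟨hy, hyu, hyv⟩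
    rw [hempty] at this
    exact this
  have hcover : M \ S ⊆ A ∪ B := fun y hy => (hsub hy).elim (fun h => Or.inl ⟨hy, h⟩) fun h => Or.inr ⟨hy, h⟩
  -- `M ⊆ closure A ∪ closure B`, two closed sets each meeting `M`
  have hMcl : M ⊆ closure A ∪ closure B := by
    intro x hx
    have h := hdense hx
    rw [← closure_union]
    exact closure_mono hcover h
  obtain ⟨x, hxM, hxA, hxB⟩ : (M ∩ (closure A ∩ closure B)).Nonempty := by
    refine isPreconnected_closed_iff.1 hM _ _ isClosed_closure isClosed_closure hMcl ?_ ?_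
    · obtain ⟨y, hy⟩ := hne_u
      exact ⟨y, hy.1.1, subset_closure (show y ∈ A from hy)⟩
    · obtain ⟨y, hy⟩ := hne_v
      exact ⟨y, hy.1.1, subset_closure (show y ∈ B from hy)⟩
  -- `x ∈ S`
  have hxS : x ∈ S := by
    by_contra hxS
    rcases hcover ⟨hxM, hxS⟩ with h | h
    · have : A ∈ 𝓝 x := hAo.mem_nhds h
      rw [mem_closure_iff_nhds] at hxB
      obtain ⟨y, hyA, hyB⟩ := hxB A this
      exact Set.disjoint_iff.1 hAB ⟨hyA, hyB⟩
    · have : B ∈ 𝓝 x := hBo.mem_nhds h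
      rw [mem_closure_iff_nhds] at hxA
      obtain ⟨y, hyB, hyA⟩ := hxA B this
      exact Set.disjoint_iff.1 hAB ⟨hyA, hyB⟩
  obtain ⟨V, hV, hVM, hVc⟩ := hloc x ⟨hxM, hxS⟩
  have hVsub : V \ S ⊆ u ∪ v := fun y hy => hsub ⟨hVM hy.1, hy.2⟩
  have hVu : ((V \ S) ∩ u).Nonempty := by
    rw [mem_closure_iff_nhds] at hxA
    obtain ⟨y, hyV, hyA⟩ := hxA V hV
    exact ⟨y, ⟨hyV, hyA.1.2⟩, hyA.2⟩
  have hVv : ((V \ S) ∩ v).Nonempty := by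
    rw [mem_closure_iff_nhds] at hxB
    obtain ⟨y, hyV, hyB⟩ := hxB V hV
    exact ⟨y, ⟨hyV, hyB.1.2⟩, hyB.2⟩
  obtain ⟨y, hy, hyu, hyv⟩ := hVc u v hu hv hVsub hVu hVv
  have : y ∈ (M \ S) ∩ (u ∩ v) := ⟨⟨hVM hy.1, hy.2⟩, hyu, hyv⟩
  rw [hempty] at this
  exact this

/-! ### §2 Punctured balls -/

section Ball

variable {E : Type*} [NormedAddCommGroup E] [NormedSpace ℝ E]

/-- **A punctured open ball is preconnected** in a real normed space of dimension `> 1`: it is the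
image of the preconnected set `(0, r) × 𝕊` under `(t, v) ↦ x + t v`. [folklore] -/
theorem isPreconnected_ball_diff_center (h : 1 < Module.rank ℝ E) (x : E) (r : ℝ) :
    IsPreconnected (ball x r \ {x}) := by
  set g : ℝ × E → E := fun p => x + p.1 • p.2 with hg
  have hgc : Continuous g := continuous_const.add (continuous_fst.smul continuous_snd)
  have himage : g '' (Ioo 0 r ×ˢ sphere (0 : E) 1) = ball x r \ {x} := by
    ext y
    constructor
    · rintro ⟨⟨t, v⟩, ⟨ht, hv⟩, rfl⟩
      have hv1 : ‖v‖ = 1 := by simpa using hv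
      have hn : ‖t • v‖ = t := by rw [norm_smul, hv1, mul_one, Real.norm_eq_abs, abs_of_pos ht.1]
      refine ⟨?_, ?_⟩
      · rw [mem_ball, dist_eq_norm]
        show ‖x + t • v - x‖ < r
        rw [add_sub_cancel_left, hn]; exact ht.2
      · intro hy
        have h0 : t • v = 0 := by
          have : x + t • v = x := hy
          simpa using this
        rw [h0, norm_zero] at hn
        linarith [ht.1]
    · rintro ⟨hy, hyx⟩
      set w := y - x with hw
      have hw0 : w ≠ 0 := sub_ne_zero.2 hyx
      have hwpos : 0 < ‖w‖ := norm_pos_iff.2 hw0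
      have hwr : ‖w‖ < r := by rw [mem_ball, dist_eq_norm] at hy; exact hy
      refine ⟨(‖w‖, ‖w‖⁻¹ • w), ⟨⟨hwpos, hwr⟩, ?_⟩, ?_⟩
      · show ‖w‖⁻¹ • w ∈ sphere (0 : E) 1
        rw [mem_sphere_zero_iff_norm, norm_smul, norm_inv, norm_norm, inv_mul_cancel₀ hwpos.ne']
      · show x + ‖w‖ • ‖w‖⁻¹ • w = y
        rw [smul_smul, mul_inv_cancel₀ hwpos.ne', one_smul, hw, add_sub_cancel]
  rw [← himage]
  exact ((isPreconnected_Ioo).prod (isPreconnected_sphere h 0 1)).image g hgc.continuousOn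

/-! ### §3 Balls minus linear subspaces of codimension `> 1` -/

/-- The radial map `y ↦ (r / √(1 + ‖y‖²)) y` sends the whole space onto the open ball of radius
`r > 0`, a point `z` of the ball being the image of `(√(r² - ‖z‖²))⁻¹ z`. [folklore] -/
theorem radial_smul_sqrt_eq {r : ℝ} (hr : 0 < r) {z : E} (hz : ‖z‖ < r) :
    (r * (Real.sqrt (1 + ‖(Real.sqrt (r ^ 2 - ‖z‖ ^ 2))⁻¹ • z‖ ^ 2))⁻¹) •
      ((Real.sqrt (r ^ 2 - ‖z‖ ^ 2))⁻¹ • z) = z := by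
  have hz0 : 0 ≤ ‖z‖ := norm_nonneg z
  have hd : 0 < r ^ 2 - ‖z‖ ^ 2 := by nlinarith
  set s : ℝ := Real.sqrt (r ^ 2 - ‖z‖ ^ 2) with hs
  have hspos : 0 < s := Real.sqrt_pos.2 hd
  have hs2 : s ^ 2 = r ^ 2 - ‖z‖ ^ 2 := Real.sq_sqrt hd.le
  have hn : ‖s⁻¹ • z‖ ^ 2 = ‖z‖ ^ 2 / s ^ 2 := by
    rw [norm_smul, norm_inv, Real.norm_eq_abs, abs_of_pos hspos, mul_pow, inv_pow]; ring
  have h1 : 1 + ‖s⁻¹ • z‖ ^ 2 = r ^ 2 / s ^ 2 := by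
    rw [hn, hs2]; field_simp; ring
  have h2 : Real.sqrt (1 + ‖s⁻¹ • z‖ ^ 2) = r / s := by
    rw [h1, show r ^ 2 / s ^ 2 = (r / s) ^ 2 by ring, Real.sqrt_sq (div_nonneg hr.le hspos.le)]
  rw [h2, smul_smul]
  have h3 : r * (r / s)⁻¹ * s⁻¹ = 1 := by field_simp
  rw [h3, one_smul]

/-- **An open ball about `0` minus a linear subspace of codimension `> 1` is preconnected**: the
radial homeomorphism `y ↦ (r/√(1 + ‖y‖²)) y` of the space onto the ball preserves the subspace,
and the complement of the subspace in the whole space is connected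
(`isConnected_compl_of_one_lt_codim`). [folklore] -/
theorem isPreconnected_ball_diff_submodule {F : Submodule ℝ E}
    (hcodim : 1 < Module.rank ℝ (E ⧸ F)) {r : ℝ} (hr : 0 < r) :
    IsPreconnected (ball (0 : E) r \ (F : Set E)) := by
  set g : E → E := fun y => (r * (Real.sqrt (1 + ‖y‖ ^ 2))⁻¹) • y with hg
  have hgc : Continuous g := by
    refine (continuous_const.mul ((continuous_const.add (continuous_norm.pow 2)).sqrt.inv₀ ?_)).smul
      continuous_id
    intro y
    show Real.sqrt (1 + ‖y‖ ^ 2) ≠ 0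
    exact (Real.sqrt_pos.2 (by positivity)).ne'
  have hcoef : ∀ y : E, 0 < r * (Real.sqrt (1 + ‖y‖ ^ 2))⁻¹ := fun y =>
    mul_pos hr (inv_pos.2 (Real.sqrt_pos.2 (by positivity)))
  have himage : g '' (F : Set E)ᶜ = ball (0 : E) r \ (F : Set E) := by
    ext z
    constructor
    · rintro ⟨y, hy, rfl⟩
      refine ⟨?_, fun hz => hy ?_⟩
      · rw [mem_ball_zero_iff]
        show ‖(r * (Real.sqrt (1 + ‖y‖ ^ 2))⁻¹) • y‖ < r
        rw [norm_smul, Real.norm_eq_abs, abs_of_pos (hcoef y), mul_assoc]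
        have h1 : (Real.sqrt (1 + ‖y‖ ^ 2))⁻¹ * ‖y‖ < 1 := by
          have hs : 0 < Real.sqrt (1 + ‖y‖ ^ 2) := Real.sqrt_pos.2 (by positivity)
          rw [inv_mul_lt_iff₀ hs, mul_one, Real.lt_sqrt (norm_nonneg y)]
          linarith
        have h2 := mul_lt_mul_of_pos_left h1 hr
        rwa [mul_one] at h2
      · have h := F.smul_mem (r * (Real.sqrt (1 + ‖y‖ ^ 2))⁻¹)⁻¹ hz
        rwa [smul_smul, inv_mul_cancel₀ (hcoef y).ne', one_smul] at h
    · rintro ⟨hz, hzF⟩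
      rw [mem_ball_zero_iff] at hz
      refine ⟨(Real.sqrt (r ^ 2 - ‖z‖ ^ 2))⁻¹ • z, fun h => hzF ?_, radial_smul_sqrt_eq hr hz⟩
      have hd : 0 < r ^ 2 - ‖z‖ ^ 2 := by nlinarith [norm_nonneg z]
      have hspos : 0 < Real.sqrt (r ^ 2 - ‖z‖ ^ 2) := Real.sqrt_pos.2 hd
      have h' := F.smul_mem (Real.sqrt (r ^ 2 - ‖z‖ ^ 2)) h
      rwa [smul_smul, mul_inv_cancel₀ hspos.ne', one_smul] at h'
  rw [← himage]
  exact (isConnected_compl_of_one_lt_codim hcodim).isPreconnected.image g hgc.continuousOn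

/-- **A ball about a point of an affine subspace of codimension `> 1`, minus that subspace, is
preconnected** (translate of `isPreconnected_ball_diff_submodule`). [folklore] -/
theorem isPreconnected_ball_diff_vadd_submodule {F : Submodule ℝ E}
    (hcodim : 1 < Module.rank ℝ (E ⧸ F)) (a : E) {r : ℝ} (hr : 0 < r) :
    IsPreconnected (ball a r \ {y | y - a ∈ F}) := by
  have h := (isPreconnected_ball_diff_submodule hcodim hr).image (fun y => a + y)
    (continuous_const.add continuous_id).continuousOn
  have himage : (fun y => a + y) '' (ball (0 : E) r \ (F : Set E)) = ball a r \ {y | y - a ∈ F} := by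
    ext z
    constructor
    · rintro ⟨y, ⟨hy, hyF⟩, rfl⟩
      refine ⟨?_, ?_⟩
      · rw [mem_ball, dist_eq_norm, add_sub_cancel_left]; rwa [mem_ball_zero_iff] at hy
      · show ¬ (a + y - a ∈ F)
        rw [add_sub_cancel_left]; exact hyF
    · rintro ⟨hz, hzF⟩
      refine ⟨z - a, ⟨?_, hzF⟩, by abel⟩
      rw [mem_ball_zero_iff]; rwa [mem_ball, dist_eq_norm] at hz
  rw [himage] at h
  exact h

end Ball

end Literature.Topology.FourManifolds

end
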